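import Summits.KontsevichZagierPeriods.Zeta5Search.WedgeDictionaryLevelDescentFaceBase
import Summits.KontsevichZagierPeriods.Zeta5Search.WedgeDictionaryLevelDescentSymmetry
import HarnessLib

/-!
# Level descent (LD@N) — S5a: the induction region, its `{1,2,7}`-symmetry, and the sorting reduction — PROVED

HONEST FRAMING: systematic search; no irrationality claim unless certified.

gen-1 g7 (planner-pub-zeta5-gen-1-g7-0); design memo `HOME/pub-zeta5-gen-1/D2-LD-PROOF-g7.md` §5, §9.
The induction proving `ldBoxW` / `ldBoxV` runs over the EXTENDED REGION
  `RW = { N ≥ 0, all slots ≥ 0, 2b_j ≤ N (j ∈ B = {3,4,5,6}), d ≥ 0, the three pair sums of the triple T = {b₁,b₂,b₇} are ≤ N,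
          min(b₁,b₂,b₇) ≤ σ − N + d }`     (`σ = b₁+b₂+b₇`; the last condition is clause 2 of `levelDescentW` in symmetric form),
(`RV = RW ∧ σ ≥ N` for the constant row), which contains every `LDBoxHyp` shape and is closed under the two moves of the step.  This file:
* `RW`, `rw_iff`, `slots_of_RW`;
* invariance under the swaps of `T`: `RW_swap`, `degShape_swap`, `ldSum_swap` (the right-hand side), `casUW_swap'`/`casUV_swap'`
  (the wedges, from `casUW_swap_holds`/`casUV_swap_holds` + `wedgeSlotFree_holds`), hence `PW_of_swap` / `PV_of_swap` for the claims
  `PW b : casUW b = ldSum W b`, `PV b : casUV b = ldSum V b`;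
(The measure `phi`, `RW_of_LDBoxHyp`, the sorting reduction and the induction itself are in `…LevelDescentInduction`.)
-/

open Finset

namespace Summit.KontsevichZagierPeriods.Zeta5Search.WedgeDictionary

open Summit.KontsevichZagierPeriods.Zeta5Search.DualSeries

/-! ## The region -/

/-- The induction region `R_W` (module docstring). -/
def RW (b : ℕ → ℤ) : Prop :=
  0 ≤ b 0 ∧ (∀ j ∈ Icc 1 7, 0 ≤ b j) ∧ (∀ j ∈ Icc 3 6, 2 * b j ≤ b 0) ∧ 0 ≤ dOf b ∧
    b 1 + b 2 ≤ b 0 ∧ b 1 + b 7 ≤ b 0 ∧ b 2 + b 7 ≤ b 0 ∧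
    min (b 1) (min (b 2) (b 7)) ≤ sigmaT b - b 0 + dOf b

/-- The claim for the `ζ(3)`-row at one shape. -/
def PW (b : ℕ → ℤ) : Prop := casUW b = ldSum coeffW b

/-- The claim for the constant row at one shape. -/
def PV (b : ℕ → ℤ) : Prop := casUV b = ldSum coeffV b


/-- `RW` spelled out. -/
theorem rw_iff (b : ℕ → ℤ) : RW b ↔
    0 ≤ b 0 ∧ (0 ≤ b 1 ∧ 0 ≤ b 2 ∧ 0 ≤ b 3 ∧ 0 ≤ b 4 ∧ 0 ≤ b 5 ∧ 0 ≤ b 6 ∧ 0 ≤ b 7) ∧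
    (2 * b 3 ≤ b 0 ∧ 2 * b 4 ≤ b 0 ∧ 2 * b 5 ≤ b 0 ∧ 2 * b 6 ≤ b 0) ∧ 0 ≤ dOf b ∧
    b 1 + b 2 ≤ b 0 ∧ b 1 + b 7 ≤ b 0 ∧ b 2 + b 7 ≤ b 0 ∧
    min (b 1) (min (b 2) (b 7)) ≤ sigmaT b - b 0 + dOf b := by
  unfold RW
  rw [Icc_one_seven, Icc_three_six]
  simp only [mem_insert, mem_singleton, forall_eq_or_imp, forall_eq]

/-- Slots of a region shape lie in `[0, N]`. -/
theorem slots_of_RW (b : ℕ → ℤ) (h : RW b) : ∀ j ∈ Icc 1 7, 0 ≤ b j ∧ b j ≤ b 0 := by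
  have h' := (rw_iff b).1 h
  intro j hj
  rw [Icc_one_seven] at hj
  simp only [mem_insert, mem_singleton] at hj
  rcases hj with rfl | rfl | rfl | rfl | rfl | rfl | rfl <;> omega

/-- Region shapes are in the box. -/
theorem inBox_of_RW (b : ℕ → ℤ) (h : RW b) : InBox b := inBox_of_slots b h.1 (slots_of_RW b h)

/-! ## Symmetry under the swaps of the triple `{1,2,7}` -/

/-- The slot triple `{1,2,7}` lies inside `Icc 1 7`. -/
theorem mem17_of_T {x : ℕ} (hx : x ∈ ({1, 2, 7} : Finset ℕ)) : x ∈ Icc 1 7 := by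
  simp only [mem_insert, mem_singleton] at hx
  rcases hx with rfl | rfl | rfl <;> simp

section transport
variable (b : ℕ → ℤ) {j k : ℕ} (hj : j ∈ ({1, 2, 7} : Finset ℕ)) (hk : k ∈ ({1, 2, 7} : Finset ℕ))
include hj hk

/-- A transposition of two slots of the triple keeps slot `7` inside `Icc 1 7`. -/
theorem swap7_mem : Equiv.swap j k 7 ∈ Icc 1 7 := by
  simp only [mem_insert, mem_singleton] at hj hk
  rcases hj with rfl | rfl | rfl <;> rcases hk with rfl | rfl | rfl <;> simp [Equiv.swap_apply_def]

/-- The region is swap-stable. -/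
theorem RW_swap (hR : RW b) : RW (fun i => b (Equiv.swap j k i)) := by
  have h := (rw_iff b).1 hR
  rw [rw_iff, sigmaT_swap b hj hk, dOf_swap b hj hk]
  simp only [mem_insert, mem_singleton] at hj hk
  rcases hj with rfl | rfl | rfl <;> rcases hk with rfl | rfl | rfl <;>
    simp [Equiv.swap_apply_def] <;> omega

/-- The degenerate shapes on the right-hand side are swap-invariant (slot 7 of `degShape b (b₇ − m)` is `m`). -/
theorem degShape_swap (m : ℤ) :
    degShape (fun i => b (Equiv.swap j k i)) (b (Equiv.swap j k 7) - m) = degShape b (b 7 - m) := by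
  funext s
  unfold degShape
  simp only [swap_b0 b hj hk]
  by_cases h1 : s = 1
  · simp [h1]
  · by_cases h2 : s = 2
    · simp [h2]
    · by_cases h7 : s = 7
      · subst h7; simp
      · simp [h1, h2, h7, swap_fix hj hk (show s ∉ ({1, 2, 7} : Finset ℕ) by simp [h1, h2, h7])]

/-- The right-hand side is swap-invariant. -/
theorem ldSum_swap (X : (ℕ → ℤ) → ℚ) : ldSum X (fun i => b (Equiv.swap j k i)) = ldSum X b := by
  unfold ldSum
  simp only [swap_b0 b hj hk]
  exact sum_congr rfl fun m _ => by rw [ldW_swap b hj hk m, degShape_swap b hj hk m]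

/-- The `U ∧ W` wedge is swap-invariant on the region. -/
theorem casUW_swap' (hR : RW b) : casUW (fun i => b (Equiv.swap j k i)) = casUW b := by
  have hS := slots_of_RW b hR
  have hb : InBox b := inBox_of_RW b hR
  have hd : 0 ≤ dOf b := hR.2.2.2.1
  have h7 := swap7_mem hj hk
  have hw := (wedgeSlotFree_holds b (Equiv.swap j k 7) h7 hb hd (hS _ h7).2 (hS 7 (by simp)).2).1
  have hc := casUW_swap_holds b j k (mem17_of_T hj) (mem17_of_T hk)
  calc casUW (fun i => b (Equiv.swap j k i))
      = coeffU b * coeffW (Function.update b (Equiv.swap j k 7) (b (Equiv.swap j k 7) + 1)) -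
          coeffU (Function.update b (Equiv.swap j k 7) (b (Equiv.swap j k 7) + 1)) * coeffW b := by
        unfold casUW; exact hc
    _ = casUW b := hw

/-- The `U ∧ V` wedge is swap-invariant on the region. -/
theorem casUV_swap' (hR : RW b) : casUV (fun i => b (Equiv.swap j k i)) = casUV b := by
  have hS := slots_of_RW b hR
  have hb : InBox b := inBox_of_RW b hR
  have hd : 0 ≤ dOf b := hR.2.2.2.1
  have h7 := swap7_mem hj hk
  have hw := (wedgeSlotFree_holds b (Equiv.swap j k 7) h7 hb hd (hS _ h7).2 (hS 7 (by simp)).2).2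
  rw [casUV_swap_holds b j k (mem17_of_T hj) (mem17_of_T hk)]
  exact hw

/-- Transport of the `ζ(3)`-row claim. -/
theorem PW_of_swap (hR : RW b) (h : PW (fun i => b (Equiv.swap j k i))) : PW b := by
  unfold PW at h ⊢
  rwa [casUW_swap' b hj hk hR, ldSum_swap b hj hk] at h

/-- Transport of the constant-row claim. -/
theorem PV_of_swap (hR : RW b) (h : PV (fun i => b (Equiv.swap j k i))) : PV b := by
  unfold PV at h ⊢
  rwa [casUV_swap' b hj hk hR, ldSum_swap b hj hk] at h

end transport

/-- STATEMENT (PROVED below as `ldTransport_holds`): the claims `PW`, `PV` and the region are stable under the swaps of the triple. -/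
def ldTransport_stmt : Prop :=
  ∀ (b : ℕ → ℤ) (j k : ℕ), j ∈ ({1, 2, 7} : Finset ℕ) → k ∈ ({1, 2, 7} : Finset ℕ) → RW b →
    RW (fun i => b (Equiv.swap j k i)) ∧ (PW (fun i => b (Equiv.swap j k i)) → PW b) ∧
      (PV (fun i => b (Equiv.swap j k i)) → PV b)

/-- `ldTransport_stmt` holds. -/
theorem ldTransport_holds : ldTransport_stmt := fun b _ _ hj hk hR =>
  ⟨RW_swap b hj hk hR, PW_of_swap b hj hk hR, PV_of_swap b hj hk hR⟩

end Summit.KontsevichZagierPeriods.Zeta5Search.WedgeDictionary
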